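/-
Origin: expansion seat `planner-pub-hodgecm-pv09-g3-0`, handover 2026-08-18T05:56:54Z (`HOME/pub-hodgecm-pv09-g3/lean/Pv09g3/LocalIntegrability.lean`, md5 4e281caa, 217 lines);
landed by the gen-6 packager in gate run 24 as `HodgeCM/PerL34/LocalIntegrability.lean` (import ^import Pv[0-9]+g[0-9]+\.→import HodgeCM.PerL34. ×1).
-/
/-
Copyright: HodgeCM publication cell (pub-hodgecm), DAG node N31 — seam S3 / seam (I) (prover pv09, gen 3).
Released under the package licence.

# Local integrability OUTSIDE `S` from the unramified place data (the hypothesis `hcl` shrinks to `S`)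

Source under adjudication (NOT cited as a fact; this file PROVES a typed piece of it):
PerL v5 = `inputs/2001/summits__hodge-w-picard-modular-quadrilinear-period-galois-
closure__free__y1__paper__paper.tex`, Lemma 4.2(b), proof, tex ll. 628–631 (verbatim l. 631):

  631: … In particular $I_v(\phi_v^0)\neq 0$ for $v\notin S$ and $\prod_{v\notin S}I_v$ converges
       absolutely. Together with Step~3, $\prod_v I_v(\phi_v)\ne0$.

## What this file does

`CanonicalPieces.canonicalPieces` (item 7) keeps the hypothesis `hcl : ∀ i, Integrable (localCoeff_i) (ν_i)`
(local integrability of the coefficient at EVERY place).  Outside `S` it FOLLOWS from the same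
`UnramifiedPlaceData` that gives the local values:
* `localCoeff_eq_f_mul_conj` : `localCoeff_i = f_i · conj χ′_i` (`χ′` unitary);
* `integrable_f_of_shells` : at a split unramified place the local integrand `f_i` is integrable (it is
  the constant `(q^{-3/2})^{|n|} aⁿ` on the shell `P n` of volume one and `Σ_n (q^{-3/2})^{|n|} < ∞`;
  Mathlib `integrableOn_iUnion_of_summable_integral_norm`, as in pv10's `hasSum_setIntegral_iUnion_of_eqOn`);
* `integrable_localCoeff_of_shells` : hence `localCoeff_i` is integrable there (`χ′_i` continuous, `|χ′_i| = 1`);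
* `integrable_localCoeff_of_nonsplit` : at a non-split unramified place `localCoeff_i ≡ 1` on `B_i = G_i`,
  a probability space — integrable;
* `UnramifiedPlaceData.hcl` : `(∀ i ∈ S, Integrable (localCoeff_i) (ν_i)) → ∀ i, Integrable (localCoeff_i) (ν_i)`;
* **`canonicalPieces'`** / **`theta_ne_zero_canonical'`** : item 7's constructor and `θ ≠ 0` with `hcl`
  replaced by `hclS : ∀ i ∈ S, Integrable (localCoeff_i) (ν_i)` (integrability at the finitely many chosen
  places only — part of the N31f model facts, pv07 lineage).
Nothing is cited; no hypothesis names PerL, QW8 or a 2001-programme claim.  Imports: item 7.  Axioms = the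
standard trio.  Unit `pub-hodgecm-pv09-g3` (DAG-node prover #09, generation 3), 2026-08-18.
-/
import Summits.HodgeConjecture.HodgeCM.PerL34.CanonicalPieces

/-! PORT of `HodgeCM/PerL34/LocalIntegrability.lean` (HodgeCMPerL run 82) — verbatim mechanical port; provenance in the PORT header line. -/

set_option autoImplicit false

noncomputable section

open MeasureTheory Set Filter Function Topology Complex ComplexConjugate

open scoped RestrictedProduct InnerProductSpace

namespace HodgeCM.PerL34.PureTensor

open HodgeCM.PerL34.AdelicFactorisation HodgeCM.PerL34.RestrictedMeasure
  HodgeCM.PerL34.NoSmallSubgroups HodgeCM.PerL34.EulerFactorisation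

section generic

variable {ι : Type} {G : ι → Type} [∀ i, Group (G i)] [DecidableEq ι]
  {Sub : ι → Type*} [∀ i, SetLike (Sub i) (G i)] [∀ i, SubgroupClass (Sub i) (G i)]
  (B : ∀ i, Sub i)
  {Sp : Type} [NormedAddCommGroup Sp] [InnerProductSpace ℂ Sp]
  (ω : (Πʳ j, [G j, B j]) →* (Sp ≃ₗᵢ[ℂ] Sp)) (φ : Sp)
  [∀ i, MeasurableSpace (G i)] [∀ i, MeasurableInv (G i)]
  (D : RestrictedProductMeasureDatum ι G (Πʳ j, [G j, B j])) [∀ i, (D.ν i).IsInvInvariant]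
  (χ : (Πʳ j, [G j, B j]) →* Circle)

/-- `localCoeff_i = f_i · conj χ′_i`. -/
theorem localCoeff_eq_f_mul_conj (i : ι) (g : G i) :
    localCoeff B ω φ i g = (localIntegrand B D ω φ χ i).f g *
      conj (((χ (RestrictedProduct.mulSingle B i g) : Circle) : ℂ)) := by
  rw [localIntegrand_f, mul_assoc, Complex.mul_conj, Complex.normSq_eq_norm_sq, Circle.norm_coe,
    one_pow, Complex.ofReal_one, mul_one]

/-- **Split unramified place: the local integrand is integrable** (from the shells). -/
theorem integrable_f_of_shells {i : ι} (P : ℤ → Set (G i))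
    (hm : ∀ n, MeasurableSet (P n)) (hcover : (⋃ n, P n) = Set.univ)
    (hvol : ∀ n, D.ν i (P n) = 1) {q : ℕ} (hq : 2 ≤ q) {a : ℂ} (ha : ‖a‖ = 1)
    (hF : ∀ n : ℤ, Set.EqOn (localIntegrand B D ω φ χ i).f
      (fun _ => ((EulerProduct.tOf q : ℝ) : ℂ) ^ n.natAbs * a ^ n) (P n)) :
    Integrable (fun g : G i => (localIntegrand B D ω φ χ i).f g) (D.ν i) := by
  have ht0 := EulerProduct.tOf_nonneg q
  have ht1 := EulerProduct.tOf_lt_one hq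
  set F : G i → ℂ := fun g => (localIntegrand B D ω φ χ i).f g with hFdef
  have hFn : ∀ n : ℤ, Set.EqOn F (fun _ => ((EulerProduct.tOf q : ℝ) : ℂ) ^ n.natAbs * a ^ n) (P n) :=
    fun n g hg => hF n hg
  have hpiece : ∀ n : ℤ, IntegrableOn F (P n) (D.ν i) := fun n =>
    (integrableOn_const (C := ((EulerProduct.tOf q : ℝ) : ℂ) ^ n.natAbs * a ^ n)
      (by rw [hvol n]; exact ENNReal.one_ne_top)).congr_fun (hFn n).symm (hm n)
  have hnorm : ∀ n : ℤ, ∫ g in P n, ‖F g‖ ∂D.ν i = EulerProduct.tOf q ^ n.natAbs := fun n => by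
    have hfg' : Set.EqOn (fun g => ‖F g‖) (fun _ => EulerProduct.tOf q ^ n.natAbs) (P n) := by
      intro g hg
      show ‖F g‖ = EulerProduct.tOf q ^ n.natAbs
      rw [hFn n hg, UnramifiedFactors.norm_term _ ht0 ha n]
    rw [setIntegral_congr_fun (hm n) hfg', setIntegral_const, Measure.real, hvol n]
    simp
  have hsum : Summable fun n : ℤ => ∫ g in P n, ‖F g‖ ∂D.ν i :=
    (hasSum_pow_natAbs ht0 ht1).summable.congr fun n => (hnorm n).symm
  have hint : IntegrableOn F (⋃ n, P n) (D.ν i) :=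
    integrableOn_iUnion_of_summable_integral_norm hpiece hsum
  rwa [hcover, integrableOn_univ] at hint

end generic

section topological

variable {ι : Type} {G : ι → Type} [∀ i, Group (G i)] [DecidableEq ι]
  [∀ i, TopologicalSpace (G i)] [∀ i, MeasurableSpace (G i)] [∀ i, OpensMeasurableSpace (G i)]
  [∀ i, MeasurableInv (G i)]
  {Sub : ι → Type*} [∀ i, SetLike (Sub i) (G i)] [∀ i, SubgroupClass (Sub i) (G i)]
  (B : ∀ i, Sub i)
  {Sp : Type} [NormedAddCommGroup Sp] [InnerProductSpace ℂ Sp]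
  (ω : (Πʳ j, [G j, B j]) →* (Sp ≃ₗᵢ[ℂ] Sp)) (φ : Sp)
  (D : RestrictedProductMeasureDatum ι G (Πʳ j, [G j, B j])) [∀ i, (D.ν i).IsInvInvariant]
  (χ : (Πʳ j, [G j, B j]) →* Circle)

/-- **Split unramified place: the local coefficient is integrable** (shells + `χ′` continuous unitary). -/
theorem integrable_localCoeff_of_shells (hχ : Continuous χ) {i : ι} (P : ℤ → Set (G i))
    (hm : ∀ n, MeasurableSet (P n)) (hcover : (⋃ n, P n) = Set.univ)
    (hvol : ∀ n, D.ν i (P n) = 1) {q : ℕ} (hq : 2 ≤ q) {a : ℂ} (ha : ‖a‖ = 1)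
    (hF : ∀ n : ℤ, Set.EqOn (localIntegrand B D ω φ χ i).f
      (fun _ => ((EulerProduct.tOf q : ℝ) : ℂ) ^ n.natAbs * a ^ n) (P n)) :
    Integrable (localCoeff B ω φ i) (D.ν i) := by
  have hf := integrable_f_of_shells B ω φ D χ P hm hcover hvol hq ha hF
  have hu : AEStronglyMeasurable
      (fun g : G i => conj (((χ (RestrictedProduct.mulSingle B i g) : Circle) : ℂ))) (D.ν i) :=
    (Complex.continuous_conj.comp (continuous_localComponent B χ hχ i)).aestronglyMeasurable
  have h := integrable_mul_of_norm_le_one hf hu fun g => by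
    rw [Complex.norm_conj, Circle.norm_coe]
  refine h.congr (Eventually.of_forall fun g => ?_)
  exact (localCoeff_eq_f_mul_conj B ω φ D χ i g).symm

omit [∀ i, TopologicalSpace (G i)] [∀ i, OpensMeasurableSpace (G i)] [∀ i, MeasurableInv (G i)]
  [∀ i, (D.ν i).IsInvInvariant] in
/-- **Non-split unramified place: the local coefficient is integrable** (`≡ 1` on `B_i = G_i`, `ν_i(G_i) = 1`). -/
theorem integrable_localCoeff_of_nonsplit (hφ : ‖φ‖ = 1) {T : Finset ι}
    (hK : ∀ k ∈ RestrictedProduct.boxSubgroup B T, ω k φ = φ) {i : ι} (hiT : i ∉ T)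
    (hBi : (B i : Set (G i)) = Set.univ) (hν : D.ν i Set.univ = 1) :
    Integrable (localCoeff B ω φ i) (D.ν i) := by
  haveI : IsProbabilityMeasure (D.ν i) := ⟨hν⟩
  have h1 : localCoeff B ω φ i = fun _ => (1 : ℂ) := funext fun k => by
    have hk : k ∈ B i := by
      have : k ∈ (B i : Set (G i)) := by rw [hBi]; exact Set.mem_univ k
      exact this
    exact localCoeff_eq_one_of_mem B ω φ hφ hK hiT hk
  rw [h1]
  exact integrable_const _

end topological

section pieces

variable {ι : Type} {G : ι → Type} [∀ i, CommGroup (G i)] [∀ i, MeasurableSpace (G i)]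
  [∀ i, MeasurableInv (G i)] [∀ i, TopologicalSpace (G i)] [∀ i, OpensMeasurableSpace (G i)]
  {Sub : ι → Type*} [∀ i, SetLike (Sub i) (G i)] [∀ i, SubgroupClass (Sub i) (G i)]
  (B : ∀ i, Sub i) [DecidableEq ι] [Countable ι]
  {Sp : Type} [NormedAddCommGroup Sp] [InnerProductSpace ℂ Sp]
  {E : Type*} [NormedAddCommGroup E] [InnerProductSpace ℂ E]

omit [Countable ι] in
/-- **`hcl` shrinks to `S`**: local integrability at every place from integrability at the finitely
many `i ∈ S` and the unramified place data outside `S`. -/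
theorem UnramifiedPlaceData.hcl {D : RestrictedProductMeasureDatum ι G (Πʳ j, [G j, B j])}
    [∀ i, (D.ν i).IsInvInvariant] {ω : (Πʳ j, [G j, B j]) →* (Sp ≃ₗᵢ[ℂ] Sp)} {φ : Sp}
    {χ : (Πʳ j, [G j, B j]) →* Circle} {S : Finset ι} {q : ι → ℕ} {chiPi nuPi : ι → ℂ}
    {IsSplit : ι → Prop} (X : UnramifiedPlaceData B D ω φ χ S q chiPi nuPi IsSplit)
    (hφ : ‖φ‖ = 1) (hχ : Continuous χ) {T : Finset ι}
    (hK : ∀ k ∈ RestrictedProduct.boxSubgroup B T, ω k φ = φ) (hTS : T ⊆ S)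
    (hclS : ∀ i ∈ S, Integrable (localCoeff B ω φ i) (D.ν i)) (i : ι) :
    Integrable (localCoeff B ω φ i) (D.ν i) := by
  by_cases hi : i ∈ S
  · exact hclS i hi
  · by_cases hs : IsSplit i
    · exact integrable_localCoeff_of_shells B ω φ D χ hχ (X.P i) (X.hm i hi hs) (X.hcover i hi hs)
        (X.hvol i hi hs) (X.two_le_q i hi) (X.a_norm i hi) (X.hF i hi hs)
    · exact integrable_localCoeff_of_nonsplit B ω φ D hφ hK (fun h => hi (hTS h)) (X.hBi i hi hs)
        (X.hν1 i hi hs)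

variable (hBopen : ∀ i, IsOpen (B i : Set (G i)))
  (D : RestrictedProductMeasureDatum ι G (Πʳ j, [G j, B j])) [∀ i, (D.ν i).IsInvInvariant]
  (hD : IsCoordinate D) (ω : (Πʳ j, [G j, B j]) →* (Sp ≃ₗᵢ[ℂ] Sp)) (φ : Sp) (hφ : ‖φ‖ = 1)
  (χ : (Πʳ j, [G j, B j]) →* Circle) (hχ : Continuous χ)
  (𝓕 : Set (Πʳ j, [G j, B j])) (K : (Πʳ j, [G j, B j]) → (Πʳ j, [G j, B j]) → ℂ) (c : ℝ)
  (c_pos : 0 < c) (vol_ne_zero : D.μ 𝓕 ≠ 0) (vol_ne_top : D.μ 𝓕 ≠ ⊤) (θ : E) (Θ : Set E)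
  (hθ : θ ∈ Θ)
  (hN31e : RallisIP.N31e_statement D.μ 𝓕 ω φ (fun y => ((χ y : Circle) : ℂ)) K (c : ℂ))
  (hnorm : ⟪θ, θ⟫_ℂ = ∫ u in 𝓕, ∫ u' in 𝓕, ((χ u : Circle) : ℂ) * conj ((χ u' : Circle) : ℂ) *
    K u u' ∂D.μ ∂D.μ)
  {T T' : Finset ι} (hK : ∀ k ∈ RestrictedProduct.boxSubgroup B T, ω k φ = φ)
  (hχT' : RestrictedProduct.boxSubgroup B T' ≤ χ.ker)
  (hM : ∀ S : Finset ι, T ⊆ S → ∀ y : (i : ↥S) → G i,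
    inner ℂ φ (ω (extendOne B S y) φ) = ∏ i : ↥S, localCoeff B ω φ i (y i))
  (hfm : AEStronglyMeasurable (fun y => inner ℂ φ (ω y φ) * ((χ y : Circle) : ℂ)) D.μ)
  {S : Finset ι} {q : ι → ℕ} {chiPi nuPi : ι → ℂ} {IsSplit : ι → Prop}
  (X : UnramifiedPlaceData B D ω φ χ S q chiPi nuPi IsSplit) (hTS : T ⊆ S) (hT'S : T' ⊆ S)
  (hclS : ∀ i ∈ S, Integrable (localCoeff B ω φ i) (D.ν i))
  (ram_pos : ∀ i ∈ S, 0 < (localIntegrand B D ω φ χ i).I)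
  (hsum : Summable fun i : {j : ι // j ∉ S} => EulerProduct.tOf (q i.1))

include hBopen hD hφ hχ c_pos vol_ne_zero vol_ne_top hθ hN31e hnorm hK hχT' hM hfm X hTS hT'S hclS
  ram_pos hsum

/-- **Item 7's constructor with `hcl` shrunk to `S`.** -/
def canonicalPieces' : LocalFactorPieces ι E :=
  canonicalPieces B hBopen D hD ω φ hφ χ hχ 𝓕 K c c_pos vol_ne_zero vol_ne_top θ Θ hθ hN31e hnorm
    hK hχT' hM hfm (X.hcl B hφ hχ hK hTS hclS) X hTS hT'S ram_pos hsum

/-- (Ported verbatim from the HodgeCMPerL package; no docstring in the source.) -/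
theorem canonicalPieces'_I (i : ι) :
    (canonicalPieces' B hBopen D hD ω φ hφ χ hχ 𝓕 K c c_pos vol_ne_zero vol_ne_top θ Θ hθ hN31e hnorm
      hK hχT' hM hfm X hTS hT'S hclS ram_pos hsum).I i = (localIntegrand B D ω φ χ i).I := rfl

/-- **Rallis / `θ ≠ 0` for the canonical data, `hcl` shrunk to `S`.** -/
theorem rallis_canonical' :
    RCLike.re ⟪θ, θ⟫_ℂ = c * (D.μ 𝓕).toReal * ∏' i, (localIntegrand B D ω φ χ i).I :=
  (canonicalPieces' B hBopen D hD ω φ hφ χ hχ 𝓕 K c c_pos vol_ne_zero vol_ne_top θ Θ hθ hN31e hnorm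
    hK hχT' hM hfm X hTS hT'S hclS ram_pos hsum).rallis

/-- (Ported verbatim from the HodgeCMPerL package; no docstring in the source.) -/
theorem theta_ne_zero_canonical' : θ ≠ 0 :=
  (canonicalPieces' B hBopen D hD ω φ hφ χ hχ 𝓕 K c c_pos vol_ne_zero vol_ne_top θ Θ hθ hN31e hnorm
    hK hχT' hM hfm X hTS hT'S hclS ram_pos hsum).toLocalFactorDatum.theta_ne_zero

end pieces

end HodgeCM.PerL34.PureTensor

end
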